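import Summits.BirchSwinnertonDyer.BirchSwinnertonDyer.Theorems.ClassRecordThreeEulerHalvesAtThreeCartanCoverInertHecke
import Summits.BirchSwinnertonDyer.BirchSwinnertonDyer.Theorems.ClassRecordThreeEulerHalvesAtThreeCartanCoverPeriodLattice
import Summits.BirchSwinnertonDyer.BirchSwinnertonDyer.Theorems.ClassRecordThreeEulerHalvesAtThreeCartanCoverStrongApprox
import HarnessLib

/-!
# Crux NUM `CartanOnePlaceDegreeLawAtThree` (stmt-BirchSwinnertonDyer-24801), line `jacquet`, stub `stub_jacquetVectorResidual` — STUB-PLAN P0: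
# the Summit-side DICTIONARY D-EV (value at `1` of `ℂ[G]·u_C` = the `ℂ`-span of the slashes `F₀ ∣[2] γ`) and D-AVG (unipotent averaging)

Seat `bsd-stepL-tam3-p1` g44 (lineage of record on crux 24801; `--supports stmt-BirchSwinnertonDyer-24801 --as helper`; SUMMON key `jv7dict`,
director-bsd (910)(a) «P0 GO»; stub-critic plan `Cruxes/CartanOnePlaceDegreeLawAtThree/STUB-PLAN-stub_jacquetVectorResidual.md` 17386d138746753d §2 (P0),
signatures token for token from `Cruxes/CartanOnePlaceDegreeLawAtThree/ScritStubJacquetVectorResidualDict.lean` 25ab2e20bea08d29 l.63–84).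
For a reduction datum `R : CoverReduction X q` (`…CartanCoverReduction`), a Cartan place `q ∈ C` and `F₀ ∈ S₂(X.Gamma)` with docking
`u_C = R.dockNonsplit hq F₀` (`…CartanCoverDocking`) and `ℂ[G]`-span `R.spanG u_C` (`…CartanCoverPeriodLattice`):
* `CoverReduction.coeEvOne R` — the value-at-`1` map `x ↦ ⇑(x 1) : IndCuspForm → (ℍ → ℂ)` (`ℂ`-linear).
* **D-EV** `map_coeEvOne_spanG_dockNonsplit` — PROVED: `coeEvOne (ℂ[G]·u_C) = span_ℂ {F₀ ∣[2] γ : γ ∈ ι(O₀'¹)}`. Elementary: a component `u_C(g)` is either `0`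
  (off the double coset `redHom(ι(O₀'¹))·T_η`) or `ρ(γ) F₀|_{Γ̄} = F₀ ∣[2] γ⁻¹` (`dockNonsplit_apply_of_witness`), and `F₀ ∣[2] γ = u_C(redHom γ⁻¹) =
  (indRep (redHom γ⁻¹) u_C)(1)`; NO strong approximation is needed for this equality (the binder `q ≠ 2` of the registered signature is kept, unused).
* **D-AVG** `exists_unipFixed_of_slashFixed` — PROVED: if some non-zero `G` in that span is fixed by `∣[2] γ` for every `γ ∈ ι(O₀'¹)` with upper-unipotent
  residue `redHom γ = n(y)`, then `ℂ[G]·u_C` contains a non-zero `N(𝔽_q)`-fixed vector: for a preimage `w` of `G` (D-EV) the average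
  `x = Σ_{y ∈ 𝔽_q} indRep(n(y)) w` is `N(𝔽_q)`-fixed (reindex the sum, `n(y₀) n(y) = n(y₀ + y)`), and `x(1) = Σ_y w(n(y)) = q·G ≠ 0` because each `n(y)` is
  `redHom γ_y` for a norm-one unit (strong approximation at the ODD place `q`, the tree's `redHom_surjective_of_odd`) and `w(redHom γ_y) = ρ(γ_y) w(1) =
  G ∣[2] γ_y⁻¹ = G`.
These are the two TREE lemmas of plan P0; with the print-shaped input (JVᴸ) they give (JV_Q) `JacquetVectorDocked` (glue in `…CartanCoverJacquetGlue`).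
Nothing about (JV₇), NUM, 24801, 19109 or any curve is proved here; BSD is proved for no curve.
[cite: KohenPacetti2016, §1.3 and §2 (arXiv:1403.7801v3 pp. 5–8)] [cite: Bump1997, Thm. 4.1.1 p. 406] [cite: VignerasLNM800, Ch. III §4 Thm. 4.3]
-/

set_option linter.dupNamespace false  -- `Summit.BirchSwinnertonDyer.BirchSwinnertonDyer.…` (summit = problem), as every file of this directory
set_option autoImplicit false

noncomputable section

open scoped Classical Pointwise MatrixGroups ModularForm

namespace Summit.BirchSwinnertonDyer.BirchSwinnertonDyer.Theorems.CartanCover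

open Literature.NumberTheory.Automorphic
open Summit.BirchSwinnertonDyer.BirchSwinnertonDyer.Theorems.CartanCover.Charext.InertHecke (upperUnip coe_upperUnip upperUnip_mul upperUnip_zero
  det_coe_upperUnip)
open CartanTorusCubeCut (torusSubgroup)

namespace CoverReduction

variable {D M : ℕ} {C : Finset ℕ} {X : CartanLevelCurveData D M C} {q : ℕ} [Fact q.Prime]

/-! ## §1 The value-at-`1` map -/

/-- The value-at-`1` map `x ↦ ⇑(x 1) : IndCuspForm → (ℍ → ℂ)` (ℂ-linear). -/
def coeEvOne (R : CoverReduction X q) : R.IndCuspForm →ₗ[ℂ] (UpperHalfPlane → ℂ) where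
  toFun x := ⇑(x.1 1)
  map_add' x y := by rfl
  map_smul' c x := by rfl

omit [Fact q.Prime] in
/-- `coeEvOne R x = ⇑(x 1)` (definitional). -/
theorem coeEvOne_apply (R : CoverReduction X q) (x : R.IndCuspForm) : coeEvOne R x = ⇑(x.1 1) := rfl

/-- The value at `1` of a translate: `coeEvOne (indRep g x) = ⇑(x g)`. -/
theorem coeEvOne_indRep (R : CoverReduction X q) (g : GL (Fin 2) (ZMod q)) (x : R.IndCuspForm) :
    coeEvOne R (R.indRep g x) = ⇑(x.1 g) := by
  rw [coeEvOne_apply, indRep_apply, one_mul]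

/-! ## §2 D-EV: the value at `1` of `ℂ[G]·u_C` is the span of the slashes `F₀ ∣[2] γ` -/

/-- A component of `u_C` at `redHom γ`, as a function: `F₀ ∣[2] γ⁻¹`. -/
theorem coe_dockNonsplit_apply_redHom (hq : q ∈ C) (R : CoverReduction X q) (F₀ : CuspForm X.Gamma 2) (γ : coverUnits X q) :
    (⇑((R.dockNonsplit hq F₀).1 (R.redHom γ)) : UpperHalfPlane → ℂ) = (⇑F₀ : UpperHalfPlane → ℂ) ∣[(2 : ℤ)] ((γ : GL (Fin 2) ℝ))⁻¹ := by
  have hw : (R.redHom γ)⁻¹ * R.redHom γ ∈ torusSubgroup R.η := by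
    rw [inv_mul_cancel]; exact (torusSubgroup R.η).one_mem
  rw [R.dockNonsplit_apply_of_witness hq F₀ hw, coverRep_apply, coe_coverSlash, coe_restrictGamma]

/-- **D-EV.** The value-at-`1` map sends `ℂ[G]·u_{F₀}` ONTO the `ℂ`-span of the slashes `F₀ ∣[2] γ` (`γ ∈ Γ' = ι(O₀'¹)`):
`(indRep g u)(1) = u(g)` is `0` off the double coset `redHom(ι(O₀'¹))·T_η` and `ρ(γ) F₀|_{Γ̄} = F₀ ∣[2] γ⁻¹` at `g = redHom γ · t`
(`indRep_apply`, `dockNonsplit_apply_of_witness`, `coverRep_apply`, `coe_coverSlash`); conversely `F₀ ∣[2] γ = (indRep (redHom γ⁻¹) u)(1)`.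
The binder `q ≠ 2` of the registered signature is not needed and kept. [cite: KohenPacetti2016, §1.3 and §2 (arXiv:1403.7801v3 pp. 5–8)] -/
theorem map_coeEvOne_spanG_dockNonsplit (hq : q ∈ C) (R : CoverReduction X q) (_hq2 : q ≠ 2) (F₀ : CuspForm X.Gamma 2) :
    Submodule.map (coeEvOne R) (R.spanG (R.dockNonsplit hq F₀)) =
      Submodule.span ℂ (Set.range fun γ : coverUnits X q => (⇑F₀ : UpperHalfPlane → ℂ) ∣[(2 : ℤ)] ((γ : GL (Fin 2) ℝ))) := by
  rw [spanG, Submodule.map_span, ← Set.range_comp]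
  apply Submodule.span_eq_span
  · rintro _ ⟨g, rfl⟩
    rw [Function.comp_apply, coeEvOne_indRep]
    by_cases hg : g ∈ R.nonsplitCoset
    · obtain ⟨γ, hγ⟩ := hg
      refine Submodule.subset_span ⟨γ⁻¹, ?_⟩
      change (⇑F₀ : UpperHalfPlane → ℂ) ∣[(2 : ℤ)] (((γ⁻¹ : coverUnits X q)) : GL (Fin 2) ℝ) = ⇑((R.dockNonsplit hq F₀).1 g)
      rw [R.dockNonsplit_apply_of_witness hq F₀ hγ, coverRep_apply, coe_coverSlash, coe_restrictGamma, Subgroup.coe_inv]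
    · rw [R.dockNonsplit_apply_of_not hq F₀ hg]
      exact Submodule.zero_mem _
  · rintro _ ⟨γ, rfl⟩
    refine Submodule.subset_span ⟨R.redHom γ⁻¹, ?_⟩
    rw [Function.comp_apply, coeEvOne_indRep, R.coe_dockNonsplit_apply_redHom hq F₀ γ⁻¹, Subgroup.coe_inv, inv_inv]

/-! ## §3 D-AVG: unipotent averaging -/

/-- **D-AVG.** Unipotent averaging: if `G = w(1)` for some `w ∈ ℂ[G]·u_{F₀}` is non-zero and fixed under `∣[2] γ` by every `γ ∈ Γ'` with `redHom γ`
upper unipotent, then `Σ_y indRep(n(y)) w ∈ ℂ[G]·u_{F₀}` is non-zero (its value at `1` is `q·G`, each `n(y)` being `redHom γ_y` by strong approximation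
at the odd place `q`, `redHom_surjective_of_odd`) and `N(𝔽_q)`-fixed (reindex the sum). [cite: Bump1997, Thm. 4.1.1 p. 406]
[cite: VignerasLNM800, Ch. III §4 Thm. 4.3 and §5 Cor. 5.7] -/
theorem exists_unipFixed_of_slashFixed (hq : q ∈ C) (R : CoverReduction X q) (hq2 : q ≠ 2) (F₀ : CuspForm X.Gamma 2)
    {G : UpperHalfPlane → ℂ}
    (hG : G ∈ Submodule.span ℂ (Set.range fun γ : coverUnits X q => (⇑F₀ : UpperHalfPlane → ℂ) ∣[(2 : ℤ)] ((γ : GL (Fin 2) ℝ))))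
    (hG0 : G ≠ 0)
    (hfix : ∀ (γ : coverUnits X q) (y : ZMod q), R.redHom γ = upperUnip y → G ∣[(2 : ℤ)] ((γ : GL (Fin 2) ℝ)) = G) :
    ∃ x ∈ R.spanG (R.dockNonsplit hq F₀), x ≠ 0 ∧ ∀ y : ZMod q, R.indRep (upperUnip y) x = x := by
  -- a preimage `w ∈ ℂ[G]·u_C` of `G` under the value-at-`1` map (D-EV)
  rw [← R.map_coeEvOne_spanG_dockNonsplit hq hq2 F₀, Submodule.mem_map] at hG
  obtain ⟨w, hw, hwG⟩ := hG
  -- every `n(y)` is the residue of a norm-one unit (strong approximation at the odd place `q`)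
  have hsa : ∀ y : ZMod q, ∃ γ : coverUnits X q, R.redHom γ = upperUnip y :=
    fun y => R.redHom_surjective_of_odd hq2 (upperUnip y) (det_coe_upperUnip y)
  choose γ hγ using hsa
  -- the value of `w` at `n(y)` is `G`
  have hval : ∀ y : ZMod q, (⇑(w.1 (upperUnip y)) : UpperHalfPlane → ℂ) = G := by
    intro y
    have h1 : (⇑(w.1 1) : UpperHalfPlane → ℂ) = G := hwG
    rw [← hγ y, R.apply_redHom w (γ y), coverRep_apply, coe_coverSlash, h1, ← Subgroup.coe_inv]
    -- `redHom γ_y⁻¹ = n(y)⁻¹ = n(-y)` (the tree's `CartanDoubleCoset.upperUnip_inv`, inlined to keep this module's imports to the cover chain)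
    exact hfix (γ y)⁻¹ (-y) (by
      rw [map_inv, hγ y]
      exact inv_eq_of_mul_eq_one_right (by rw [upperUnip_mul, add_neg_cancel, upperUnip_zero]))
  have hval' : ∀ y : ZMod q, coeEvOne R (R.indRep (upperUnip y) w) = G := fun y => by
    rw [coeEvOne_indRep, hval y]
  -- the average over `N(𝔽_q)`
  refine ⟨∑ y : ZMod q, R.indRep (upperUnip y) w, Submodule.sum_mem _ fun y _ => R.indRep_mem_spanG _ _ hw, ?_, ?_⟩
  · intro h0
    have h1 : coeEvOne R (∑ y : ZMod q, R.indRep (upperUnip y) w) = (q : ℂ) • G := by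
      rw [map_sum]
      simp_rw [hval']
      rw [Finset.sum_const, Finset.card_univ, ZMod.card, Nat.cast_smul_eq_nsmul]
    rw [h0, map_zero] at h1
    have hq0 : (q : ℂ) ≠ 0 := Nat.cast_ne_zero.mpr (Fact.out : q.Prime).ne_zero
    exact smul_ne_zero hq0 hG0 h1.symm
  · intro y₀
    rw [map_sum]
    simp_rw [← Module.End.mul_apply, ← map_mul, upperUnip_mul]
    exact Fintype.sum_equiv (Equiv.addLeft y₀) _ _ fun y => rfl

end CoverReduction

end Summit.BirchSwinnertonDyer.BirchSwinnertonDyer.Theorems.CartanCover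

end
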